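import Literature.MathematicalPhysics.QuantumFieldTheory.Balaban1983to89.B3Eq26ConstBox
import Literature.MathematicalPhysics.QuantumFieldTheory.Balaban1983to89.B3Ineq31ZeroBox

/-!
# `Balaban1983to89.B3Ineq31ConstBox` — T. Bałaban, *(Higgs)₂,₃ quantum fields in a finite volume. III. Renormalization*,
# Commun. Math. Phys. **88** (1983) 411–445 [Balaban1983Higgs3]: the external-field estimate (3.1) p. 432
# `‖hG_k(Ω,B̃)h′‖_{1,α} ≤ O(1)e^{−δ₀dist(□(v),□(v′))}` PROVED for the MODEL INSTANCE `Ω = □`, `B̃ = B̃₀` a NON-ZERO CONSTANT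
# background, `N` colours, unit-cube localizations — `Sect3Data.Ineq31 α δ₀ C` DISCHARGED, uniformly in `B̃₀`, for the carrier
# `sect3ConstBox` whose two-variable (1.32) norm carries the COVARIANT derivatives `D^η_{B̃₀}` in both variables and the
# TRANSPORTS `U(B̃₀(Γ))` on both sides — by the p. 433 gauge step on top of the zero-field instance `B3Ineq31ZeroBox`

statement-level skeleton of published theorems with citation tags; proofs where landed; nothing here is a claim about the Yang–Mills mass gap

PDF held: `paper:balaban1983-higgs-2-3-quantum-fields-finite-volume` (journal page = PDF page + 410); p. 420 [PDF 10] ((1.32) and «This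
definition extends in a natural way to functions of many variables … we localize simply by representing Ω₁ as a sum of unit cubes»),
p. 432 [PDF 22] ((3.1)), p. 433 [PDF 23] (the gauge transformation removing `B̃₀`), p. 434 [PDF 24] (the norms sentence) read in the
OCR text (`p0010.txt`, `p0022.txt`, `p0023.txt`, `p0024.txt`).

CITATION HEADER (lean-in-tree rule).  Part of the lit-balaban TYPED SKELETON (HOME `run/shared/lean/pub/lit-balaban/`), Phase 2,
proof seat **p03 gen 7** (unit `lit-balaban-p03-g7`); SKELETON row **B3.Eq3.1** (fold owner r15, `HOME/lit-balaban-r15/ROWS-B3.md`;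
decl of record `B3Sect3Statements.Sect3Data.Ineq31`, typed p239220).  CONSTANT-BACKGROUND TWIN of this seat's zero-field box instance
`B3Ineq31ZeroBox` (gen 4, p256797: `sect3ZeroBox`, `normHGH`, `sites`/`bonds`/`dirOf`/`baseOf`/`pdist`/`cubeDist`/`kerF`/`derivF`,
`ineq31_zeroBox` — all USED BY NAME) over this generation's `B3Eq26ConstBox` (p304272: the covariant propagator `GfineA0 … k`,
`GfineA0_eq`/`GfineA0_apply`/`blk2_GfineA0`, the transporter `Ub`, `covDiff_conj`); nothing re-proved, no existing module touched.

WHAT IS PRINTED.  p. 432: *"Now if two vertices, v, v′ have localizations satisfying dist(□(v), □(v′)) ≥ 1, then we consider every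
propagator corresponding to a line connecting these vertices as an external field also. Such a possibility is assured by the
following estimates ‖hG_k(Ω,B̃)h′‖_{1,α} ≤ O(1)e^{−δ₀dist(□(v),□(v′))}, (3.1) and similarly for the vector field propagator, h, h′
are localization functions."*  (1.32) p. 420: *"‖f‖_{1,α} = sup_x |f(x)| + sup_{x,μ} |(D^η_{B̃,μ}f)(x)| + sup_{x,x′,μ}
|x − x′|^{−α}|U(B̃(Γ_{x,x′}))(D^η_{B̃,μ}f)(x′) − (D^η_{B̃,μ}f)(x)| … This definition extends in a natural way to functions of many
variables."*  p. 433/434: *"Our next operation is the gauge transformation which removes the field B̃₀. … We get the same expressions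
as above with B̃₀ = 0 only (and external scalar fields gauge transformed). … these norms are equal to the norms defined by (1.32)
with B̃ = B̃₀."*

WHAT IS REPRODUCED (kind «model-instance», G.1 of `HOME/PHASE2-TARGETS.md`), in the setting of `B3Eq26ConstBox` (fine box
`□ ∩ ηℤ^{d+1}`, `η = L^{−k}`, `N` colours `ℝ^N = ι → ℝ`, orthogonal flow `F`, `κ = eη`, constant `B̃₀`):
* §2 the two-variable (1.32) DATA of the covariant propagator `F(x,x′) = G^η_k(□,B̃₀;x,x′)` on `□(v) × □(v′)`: matrix values `kerFA`
  (blocks read as functions `ι → ι → ℝ`, sup norm over the entries), covariant derivatives `derivFA` in all `2(d+1)` directions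
  (row bonds: `U(B̃₀,⟨x,xe⟩)F(xe,x′) − F(x,x′)`; column bonds: `F(x,x′e)U(B̃₀,⟨x′,x′e⟩)ᵀ − F(x,x′)` — the second argument transforms by
  the transpose), two-sided transports `tauFA` (`U(B̃₀(Γ_{x,y}))·D·U(B̃₀(Γ_{x′,y′}))ᵀ`, contour-independent), the norm **`normHGHA`** =
  r15's `norm132` over gen 4's `sites`/`bonds`/`dirOf`/`baseOf`/`pdist`, and **the carrier `sect3ConstBox : Sect3Data`**
  (`ineq31_iff` = `Iff.rfl`);
* §3 «the same expressions with B̃₀ = 0»: values `kerFA_eq`, covariant derivatives `derivFA_eq`, transported derivatives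
  `tauFA_derivFA_eq` — each the zero-field ingredient times the orthogonal transporter `g(x)g(x′)ᵀ` (`pairU`); hence
  **`normHGHA_le`**: `‖hG_k(□,B̃₀)h′‖_{1,α} ≤ ‖hG_k(□,0)h′‖_{1,α}`;
* §4 **`ineq31_constBox`**: for every `0 ≤ α < 1`, `∃ δ₀ C > 0` (on `d + 1`, `L`, the window, `α`; NOT on `B̃₀`, `κ`, the flow)
  `∀ k ≥ 1 ∀ window ∀ □ ∀ B̃₀`, `(sect3ConstBox …).Ineq31 α δ₀ C`; witness `ineq31_constBox_witness` (the U(1) instance with link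
  variables `U(π) = −1` of `B3Ineq210ConstBox.witness_link_ne_one`).

HONEST SCOPE / DECLARED DIVERGENCES (F7).  (i) `Ω = □` (Neumann box), `B̃ = B̃₀` CONSTANT (the print's general small `B̃` needs the
p. 433 `B̃′`-expansion / [B4] (2.23)–(2.33), not formalised), unit-cube (indicator) localizations as in `B3Ineq31ZeroBox` (its
HONEST SCOPE (ii) applies verbatim), «similarly for the vector field propagator» not treated (the vector propagator does not see
`B̃`).  (ii) Block values are read as functions `ι → ι → ℝ` with the sup norm over entries; for the blocks `c·U`, `U` orthogonal, of
this instance this is `≤ |c|` (= the operator norm), so the domination and (3.1) hold under either reading of `|·|` on `End(ℝ^N)`.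
(iii) Abelian one-parameter orthogonal structure group; box `□ ⊂ ηℤ^{d+1}`, not the torus (the linear gauge is not periodic) —
the p. 433 setting.  (iv) «extends in a natural way to functions of many variables» READ as in gen 4 (product lattice, derivatives in
all `2(d+1)` directions, Hölder quotients over same-direction bond pairs, sup distance of base points) WITH the natural covariant
structure: left transport in the first variable, transposed (right) transport in the second.  (v) `∀ α ∈ [0,1) ∃ (δ₀, C)`
(G-B3-11), existential constants.  (vi) ROUTE = the print's (gauge step p. 433 + the zero-field instance); no Literature fact minted
(defs with bodies, theorems proved); standard axioms.  Value = kernel certificate that (3.1) at a constant background on boxes IS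
the zero-field (3.1) dressed with orthogonal transporters; NOT summit progress.
Unit `lit-balaban-p03-g7` (Phase-2 proof seat p03, gen 7); HOME `run/shared/lean/pub/lit-balaban/` (row B3.Eq3.1; FILED.md, STATUS.md).
-/

namespace Literature.MathematicalPhysics.QuantumFieldTheory.Balaban1983to89.B3Ineq31ConstBox

open Matrix Finset
open scoped Kronecker NNReal
open B4GaugeCovariance
open B4Reflection242 (boxDom mem_boxDom)
open B4ContourShift (supNorm)
open B4Thm110ZeroBox (Nf Gfine one_lt_L_real)
open B3Sect3Statements
open B3Sect1Statements (norm132)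
open LatticeNorms (supNorm holderSeminorm)
open B3Ineq31ZeroBox (cubeDist kerF sites bonds derivF dirOf baseOf pdist normHGH sect3ZeroBox ineq31_zeroBox)
open B3Eq26ConstBox

noncomputable section

variable {d : ℕ} {ι : Type} [Fintype ι] [DecidableEq ι]

/-! ## §1 Two monotonicity facts for the ingredients of (1.32), and the size of a block read as a function `ι → ι → ℝ` -/

section Mono

variable {X κ' E₁ E₂ : Type*} [SeminormedAddCommGroup E₁] [SeminormedAddCommGroup E₂]

omit [Fintype ι] [DecidableEq ι] in
/-- kernel: the sup part of (1.32) is monotone in the sitewise norms. [folklore] -/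
private theorem supNorm_mono {S : Finset X} {f : X → E₁} {f' : X → E₂} (h : ∀ x, ‖f x‖ ≤ ‖f' x‖) :
    LatticeNorms.supNorm S f ≤ LatticeNorms.supNorm S f' := by
  unfold LatticeNorms.supNorm
  exact NNReal.coe_le_coe.mpr (Finset.sup_mono_fun fun x _ => by
    have := h x
    exact NNReal.coe_le_coe.mp (by simpa using this))

omit [Fintype ι] [DecidableEq ι] in
/-- kernel: the Hölder part of (1.32) is monotone in the norms of the transported differences. [folklore] -/
private theorem holderSeminorm_mono {α : ℝ} {adm : κ' → κ' → Prop} {dist : κ' → κ' → ℝ} {τ : κ' → κ' → E₁ → E₁}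
    {τ' : κ' → κ' → E₂ → E₂} {S : Finset κ'} {f : κ' → E₁} {f' : κ' → E₂}
    (h : ∀ p q, ‖τ p q (f q) - f p‖ ≤ ‖τ' p q (f' q) - f' p‖) :
    holderSeminorm α adm dist τ S f ≤ holderSeminorm α adm dist τ' S f' := by
  unfold LatticeNorms.holderSeminorm
  refine NNReal.coe_le_coe.mpr (Finset.sup_mono_fun fun p _ => ?_)
  have h1 : ‖τ p.1 p.2 (f p.2) - f p.1‖₊ ≤ ‖τ' p.1 p.2 (f' p.2) - f' p.1‖₊ :=
    NNReal.coe_le_coe.mp (by simpa using h p.1 p.2)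
  simpa only [div_eq_mul_inv] using mul_le_mul_of_nonneg_right h1 (bot_le : (0 : ℝ≥0) ≤ ((dist p.1 p.2 ^ α).toNNReal)⁻¹)

/-- kernel: a block `t·O` with `O` orthogonal, read as a function `ι → ι → ℝ` with the sup norm, has norm `≤ |t|`. [folklore] -/
private theorem pi_norm_smul_orth_le {O : Matrix ι ι ℝ} (hO : Oᵀ * O = 1) (t : ℝ) :
    ‖(fun i i' => t * O i i' : ι → ι → ℝ)‖ ≤ |t| := by
  refine (pi_norm_le_iff_of_nonneg (abs_nonneg t)).2 fun i => (pi_norm_le_iff_of_nonneg (abs_nonneg t)).2 fun i' => ?_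
  rw [Real.norm_eq_abs, abs_mul]
  exact mul_le_of_le_one_right (abs_nonneg t) (abs_apply_le_one_of_orthogonal hO i i')

/-- kernel: `g(x)g(y)ᵀ · g(y)g(z)ᵀ = g(x)g(z)ᵀ`. [folklore] -/
private theorem pair_mul_pair {g : X → Matrix ι ι ℝ} (hg : IsGauge g) (x y z : X) :
    g x * (g y)ᵀ * (g y * (g z)ᵀ) = g x * (g z)ᵀ := by
  rw [Matrix.mul_assoc, ← Matrix.mul_assoc (g y)ᵀ (g y), hg y, Matrix.one_mul]

end Mono

/-! ## §2 The two-variable (1.32) data of the propagator `G_k(□, B̃₀)` on `□(v) × □(v′)`: matrix values, covariant derivatives in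
all `2(d+1)` directions, two-sided transports -/

section Data

variable (F : OrthFlow ι) (κ : ℝ) (A₀ : Fin (d + 1) → ℝ) (ℓ k : ℕ) (M : Fin (d + 1) → ℕ) (a m2 : ℝ)

/-- the transporter `g(x)g(x′)ᵀ = U(B̃₀(Γ_{x,x′}))` as a function of the pair `z = (x, x′)`. [cite: Balaban1983Higgs3, (1.32) p.420] -/
def pairU (z : ↥(boxDom (Nf ℓ k M)) × ↥(boxDom (Nf ℓ k M))) : Matrix ι ι ℝ :=
  gA0 F κ A₀ ℓ k M z.1 * (gA0 F κ A₀ ℓ k M z.2)ᵀ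

/-- **the two-variable field of (3.1) at the constant background**: `F(x,x′) = G^η_k(□,B̃₀;x,x′) = η^{−(d+1)}G_k(□,B̃₀)((x,·),(x′,·))`,
an `N × N` block (the covariant propagator `GfineA0 … k` = [B4] (1.6) at `B̃₀`, file `B3Eq26ConstBox`), read as a function
`ι → ι → ℝ` (sup norm over the entries). [cite: Balaban1983Higgs3, (3.1) p.432] -/
def kerFA (z : ↥(boxDom (Nf ℓ k M)) × ↥(boxDom (Nf ℓ k M))) : ι → ι → ℝ :=
  fun i i' => ((((ℓ + 1) ^ k : ℕ)) : ℝ) ^ (d + 1) * GfineA0 F κ A₀ ℓ k M k a m2 (z.1, i) (z.2, i')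

/-- **the covariant derivatives of the two-variable field in all `2(d+1)` directions** ((1.32) «extends in a natural way to functions
of many variables»; [B4] (1.3)): on a ROW bond `inl (μ, (x,x′), xe)` the covariant difference in the first variable
`η^{−1}(U(B̃₀,⟨x,xe⟩)F(xe,x′) − F(x,x′))` (`B3Eq26ConstBox.covDiff`), on a COLUMN bond `inr (ν, (x,x′), x′e)` the covariant
difference in the second variable `η^{−1}(F(x,x′e)U(B̃₀,⟨x′,x′e⟩)ᵀ − F(x,x′))` (the second argument transforms by the transpose).
[cite: Balaban1983Higgs3, (1.32) p.420] -/
def derivFA : ((Fin (d + 1) × ((↥(boxDom (Nf ℓ k M)) × ↥(boxDom (Nf ℓ k M))) × ↥(boxDom (Nf ℓ k M)))) ⊕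
      (Fin (d + 1) × ((↥(boxDom (Nf ℓ k M)) × ↥(boxDom (Nf ℓ k M))) × ↥(boxDom (Nf ℓ k M))))) → (ι → ι → ℝ) :=
  Sum.elim
    (fun b i i' => (((ℓ + 1) ^ k : ℕ) : ℝ) * (((((ℓ + 1) ^ k : ℕ)) : ℝ) ^ (d + 1)
      * (Ub F κ A₀ ℓ k M b.2.1.1 b.2.2 * blk2 (GfineA0 F κ A₀ ℓ k M k a m2) b.2.2 b.2.1.2
          - blk2 (GfineA0 F κ A₀ ℓ k M k a m2) b.2.1.1 b.2.1.2) i i'))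
    (fun b i i' => (((ℓ + 1) ^ k : ℕ) : ℝ) * (((((ℓ + 1) ^ k : ℕ)) : ℝ) ^ (d + 1)
      * (blk2 (GfineA0 F κ A₀ ℓ k M k a m2) b.2.1.1 b.2.2 * (Ub F κ A₀ ℓ k M b.2.1.2 b.2.2)ᵀ
          - blk2 (GfineA0 F κ A₀ ℓ k M k a m2) b.2.1.1 b.2.1.2) i i'))

/-- **the transport of (1.32) for the two-variable field**: a derivative value at the bond `c′` based at `(y,y′)` is carried to the
base point `(x,x′)` of `c` by `U(B̃₀(Γ_{x,y}))` on the left and `U(B̃₀(Γ_{x′,y′}))ᵀ` on the right (both contour-independent,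
`B3Eq26ConstBox.transport_eq_Ub`). [cite: Balaban1983Higgs3, (1.32) p.420] -/
def tauFA (c c' : ((Fin (d + 1) × ((↥(boxDom (Nf ℓ k M)) × ↥(boxDom (Nf ℓ k M))) × ↥(boxDom (Nf ℓ k M)))) ⊕
      (Fin (d + 1) × ((↥(boxDom (Nf ℓ k M)) × ↥(boxDom (Nf ℓ k M))) × ↥(boxDom (Nf ℓ k M))))))
    (D : ι → ι → ℝ) : ι → ι → ℝ :=
  fun i i' => (Ub F κ A₀ ℓ k M (baseOf ℓ k M c).1 (baseOf ℓ k M c').1 * Matrix.of D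
    * (Ub F κ A₀ ℓ k M (baseOf ℓ k M c).2 (baseOf ℓ k M c').2)ᵀ) i i'

/-- **‖hG_k(□,B̃₀)h′‖_{1,α} for the constant-background instance**: the printed (1.32) SUM form `B3Sect1Statements.norm132` of the
two-variable field `kerFA` on the localization domain `□(v) × □(v′)` (gen 4's `sites`/`bonds`/`dirOf`/`baseOf`/`pdist` of
`B3Ineq31ZeroBox`, verbatim), with the COVARIANT derivatives `derivFA` and the two-sided TRANSPORTS `tauFA` — the same reading of
«extends in a natural way to functions of many variables» as the zero-field instance, now with `B̃ = B̃₀`.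
[cite: Balaban1983Higgs3, (3.1) p.432] -/
def normHGHA (α : ℝ) (v v' : Fin (d + 1) → ℤ) : ℝ :=
  norm132 α (fun c c' => dirOf ℓ k M c = dirOf ℓ k M c') (fun c c' => pdist ℓ k M (baseOf ℓ k M c) (baseOf ℓ k M c'))
    (tauFA F κ A₀ ℓ k M) (sites ℓ k M v v') (bonds ℓ k M v v') (kerFA F κ A₀ ℓ k M a m2) (derivFA F κ A₀ ℓ k M a m2)

/-- **The concrete carrier of B3 §3 for the MODEL INSTANCE `Ω = □`, `B̃ = B̃₀` CONSTANT, `N` colours** with the (3.1) fields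
modelled: localization functions = the unit cubes `□(v)` (integer corners `v`), `distCubes = dist(□(v),□(v′))` (`cubeDist`),
`normHGH α h h′ = ‖hG_k(□,B̃₀)h′‖_{1,α}` (`normHGHA`); the (3.2)–(3.5) data NOT modelled (`RenClass′ = ∅`, as in the zero-field
carrier `sect3ZeroBox`, so `Ineq32`/`Ineq33`/`Claim35` are vacuous here and nothing is claimed about them).
[cite: Balaban1983Higgs3, (3.1) p.432] -/
def sect3ConstBox : Sect3Data where
  eRun := 0
  lamRun := 0
  LocFn := Fin (d + 1) → ℤ
  distCubes := cubeDist
  normHGH := fun α v v' => normHGHA F κ A₀ ℓ k M a m2 α v v'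
  RenClass' := PEmpty
  Loc := fun G => G.elim
  ExtS := PUnit
  ExtV := PUnit
  E' := fun G => G.elim
  E3 := fun G => G.elim
  dv := fun G => G.elim
  ds := fun G => G.elim
  normS := fun _ _ => 0
  normV := fun _ _ => 0
  lhs35 := fun G => G.elim
  GenFamily := fun G => G.elim
  rhs35 := fun G => G.elim
  PosAlongOrderings := fun G => G.elim

/-- `(3.1)` for the carrier unfolds to the bound on `normHGHA`. [cite: Balaban1983Higgs3, (3.1) p.432] -/
theorem ineq31_iff (α δ₀ C : ℝ) :
    (sect3ConstBox F κ A₀ ℓ k M a m2).Ineq31 α δ₀ C ↔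
      ∀ v v' : Fin (d + 1) → ℤ, 1 ≤ cubeDist v v' →
        normHGHA F κ A₀ ℓ k M a m2 α v v' ≤ C * Real.exp (-(δ₀ * cubeDist v v')) := Iff.rfl

end Data

/-! ## §3 «The same expressions as above with B̃₀ = 0 only»: every ingredient is the zero-field one times the orthogonal transporter
`g(x)g(x′)ᵀ`, hence the norm is DOMINATED by the zero-field norm -/

section Compare

variable {F : OrthFlow ι} {κ : ℝ} {A₀ : Fin (d + 1) → ℝ} {ℓ k : ℕ} {M : Fin (d + 1) → ℕ} {a m2 : ℝ}

/-- kernel: the transporter of a pair is orthogonal. [folklore] -/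
private theorem pairU_orth (z : ↥(boxDom (Nf ℓ k M)) × ↥(boxDom (Nf ℓ k M))) :
    (pairU F κ A₀ ℓ k M z)ᵀ * pairU F κ A₀ ℓ k M z = 1 :=
  gA0_pair_orth (F := F) (κ := κ) (A₀ := A₀) ℓ k M z.1 z.2

/-- **values**: `F_{B̃₀}(x,x′) = F_0(x,x′)·g(x)g(x′)ᵀ` (`B3Eq26ConstBox.blk2_GfineA0`). [cite: Balaban1983Higgs3, p.433] -/
theorem kerFA_eq (hℓ : 1 ≤ ℓ) (hk : 1 ≤ k) (hM : ∀ i, 1 ≤ M i) (ha : 0 < a) (hm : 0 ≤ m2)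
    (z : ↥(boxDom (Nf ℓ k M)) × ↥(boxDom (Nf ℓ k M))) :
    kerFA F κ A₀ ℓ k M a m2 z = fun i i' => kerF ℓ k M a m2 z * pairU F κ A₀ ℓ k M z i i' := by
  funext i i'
  rw [kerFA, GfineA0_apply hℓ hk le_rfl hM ha hm, kerF, pairU, mul_assoc]

/-- kernel: the ROW covariant difference of the conjugated propagator. [folklore] -/
private theorem rowDiff_eq (hℓ : 1 ≤ ℓ) (hk : 1 ≤ k) (hM : ∀ i, 1 ≤ M i) (ha : 0 < a) (hm : 0 ≤ m2)
    (x xe x' : ↥(boxDom (Nf ℓ k M))) :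
    Ub F κ A₀ ℓ k M x xe * blk2 (GfineA0 F κ A₀ ℓ k M k a m2) xe x' - blk2 (GfineA0 F κ A₀ ℓ k M k a m2) x x'
      = (Gfine ℓ k M k a m2 xe x' - Gfine ℓ k M k a m2 x x') • (gA0 F κ A₀ ℓ k M x * (gA0 F κ A₀ ℓ k M x')ᵀ) := by
  have h := covDiff_conj (F := F) (κ := κ) (A₀ := A₀) (Gfine ℓ k M k a m2) x xe x'
  rw [covDiff, ← GfineA0_eq hℓ hk le_rfl hM ha hm] at h
  exact h

/-- kernel: the COLUMN covariant difference of the conjugated propagator. [folklore] -/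
private theorem colDiff_eq (hℓ : 1 ≤ ℓ) (hk : 1 ≤ k) (hM : ∀ i, 1 ≤ M i) (ha : 0 < a) (hm : 0 ≤ m2)
    (x x' xe' : ↥(boxDom (Nf ℓ k M))) :
    blk2 (GfineA0 F κ A₀ ℓ k M k a m2) x xe' * (Ub F κ A₀ ℓ k M x' xe')ᵀ - blk2 (GfineA0 F κ A₀ ℓ k M k a m2) x x'
      = (Gfine ℓ k M k a m2 x xe' - Gfine ℓ k M k a m2 x x') • (gA0 F κ A₀ ℓ k M x * (gA0 F κ A₀ ℓ k M x')ᵀ) := by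
  rw [blk2_GfineA0 hℓ hk le_rfl hM ha hm, blk2_GfineA0 hℓ hk le_rfl hM ha hm, Ub_eq_pair, Matrix.transpose_mul,
    Matrix.transpose_transpose, Matrix.smul_mul, pair_mul_pair (isGauge_gA0 F κ A₀ ℓ k M), sub_smul]

/-- **covariant derivatives**: on every bond index `c` (row or column), `(D F_{B̃₀})(c) = (∂F_0)(c)·g(x)g(x′)ᵀ` with `(x,x′)` the base
point of `c` — the zero-field lattice derivative `B3Ineq31ZeroBox.derivF` times the transporter. [cite: Balaban1983Higgs3, p.433] -/
theorem derivFA_eq (hℓ : 1 ≤ ℓ) (hk : 1 ≤ k) (hM : ∀ i, 1 ≤ M i) (ha : 0 < a) (hm : 0 ≤ m2)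
    (c : ((Fin (d + 1) × ((↥(boxDom (Nf ℓ k M)) × ↥(boxDom (Nf ℓ k M))) × ↥(boxDom (Nf ℓ k M)))) ⊕
      (Fin (d + 1) × ((↥(boxDom (Nf ℓ k M)) × ↥(boxDom (Nf ℓ k M))) × ↥(boxDom (Nf ℓ k M)))))) :
    derivFA F κ A₀ ℓ k M a m2 c = fun i i' => derivF ℓ k M a m2 c * pairU F κ A₀ ℓ k M (baseOf ℓ k M c) i i' := by
  funext i i'
  rcases c with b | b
  · simp only [derivFA, Sum.elim_inl, rowDiff_eq hℓ hk hM ha hm, Matrix.smul_apply, smul_eq_mul, derivF, kerF, baseOf, pairU]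
    ring
  · simp only [derivFA, Sum.elim_inr, colDiff_eq hℓ hk hM ha hm, Matrix.smul_apply, smul_eq_mul, derivF, kerF, baseOf, pairU]
    ring

/-- **transported derivatives**: carrying `(D F_{B̃₀})(c′)` to the base point of `c` with the two-sided transport gives
`(∂F_0)(c′)·g(x)g(x′)ᵀ` — the transports compensate the gauge factors exactly (p. 434). [cite: Balaban1983Higgs3, p.434] -/
theorem tauFA_derivFA_eq (hℓ : 1 ≤ ℓ) (hk : 1 ≤ k) (hM : ∀ i, 1 ≤ M i) (ha : 0 < a) (hm : 0 ≤ m2)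
    (c c' : ((Fin (d + 1) × ((↥(boxDom (Nf ℓ k M)) × ↥(boxDom (Nf ℓ k M))) × ↥(boxDom (Nf ℓ k M)))) ⊕
      (Fin (d + 1) × ((↥(boxDom (Nf ℓ k M)) × ↥(boxDom (Nf ℓ k M))) × ↥(boxDom (Nf ℓ k M)))))) :
    tauFA F κ A₀ ℓ k M c c' (derivFA F κ A₀ ℓ k M a m2 c')
      = fun i i' => derivF ℓ k M a m2 c' * pairU F κ A₀ ℓ k M (baseOf ℓ k M c) i i' := by
  funext i i'
  have hD : Matrix.of (derivFA F κ A₀ ℓ k M a m2 c') = derivF ℓ k M a m2 c' • pairU F κ A₀ ℓ k M (baseOf ℓ k M c') := by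
    ext j j'
    rw [Matrix.of_apply, derivFA_eq hℓ hk hM ha hm, Matrix.smul_apply, smul_eq_mul]
  rw [tauFA, hD, Ub_eq_pair, Ub_eq_pair, pairU, Matrix.transpose_mul, Matrix.transpose_transpose, Matrix.mul_smul,
    pair_mul_pair (isGauge_gA0 F κ A₀ ℓ k M), Matrix.smul_mul, pair_mul_pair (isGauge_gA0 F κ A₀ ℓ k M), Matrix.smul_apply,
    smul_eq_mul, pairU]

/-- **DOMINATION**: `‖hG_k(□,B̃₀)h′‖_{1,α} ≤ ‖hG_k(□,0)h′‖_{1,α}` for all cubes and every `α` (on the window) — each of the three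
summands of (1.32) at `B̃₀` is the zero-field one up to an orthogonal transporter, whose entries are `≤ 1`.
[cite: Balaban1983Higgs3, (3.1) p.432] -/
theorem normHGHA_le (hℓ : 1 ≤ ℓ) (hk : 1 ≤ k) (hM : ∀ i, 1 ≤ M i) (ha : 0 < a) (hm : 0 ≤ m2) (α : ℝ)
    (v v' : Fin (d + 1) → ℤ) :
    normHGHA F κ A₀ ℓ k M a m2 α v v' ≤ normHGH ℓ k M a m2 α v v' := by
  unfold normHGHA B3Ineq31ZeroBox.normHGH B3Sect1Statements.norm132
  refine add_le_add (add_le_add (supNorm_mono fun z => ?_) (supNorm_mono fun c => ?_)) (holderSeminorm_mono fun c c' => ?_)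
  · rw [kerFA_eq hℓ hk hM ha hm, Real.norm_eq_abs]
    exact pi_norm_smul_orth_le (pairU_orth z) _
  · rw [derivFA_eq hℓ hk hM ha hm, Real.norm_eq_abs]
    exact pi_norm_smul_orth_le (pairU_orth _) _
  · rw [tauFA_derivFA_eq hℓ hk hM ha hm, derivFA_eq hℓ hk hM ha hm, Real.norm_eq_abs]
    have : ((fun i i' => derivF ℓ k M a m2 c' * pairU F κ A₀ ℓ k M (baseOf ℓ k M c) i i') -
        fun i i' => derivF ℓ k M a m2 c * pairU F κ A₀ ℓ k M (baseOf ℓ k M c) i i' : ι → ι → ℝ)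
        = fun i i' => (derivF ℓ k M a m2 c' - derivF ℓ k M a m2 c) * pairU F κ A₀ ℓ k M (baseOf ℓ k M c) i i' := by
      funext i i'
      simp only [Pi.sub_apply]
      ring
    rw [this]
    exact pi_norm_smul_orth_le (pairU_orth _) _

end Compare

/-! ## §4 (3.1) DISCHARGED for the constant-background box instance, for each Hölder exponent, uniformly in `B̃₀` -/

section Discharge

/-- **B3 (3.1) p. 432 [PDF 22] — `Sect3Data.Ineq31 α δ₀ C` DISCHARGED for the MODEL INSTANCE `Ω = □`, `B̃ = B̃₀` CONSTANT ≠ 0, `N`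
colours, unit-cube localizations, WITH covariant derivatives and transports in both variables.**  Verbatim: *"Now if two vertices,
v, v′ have localizations satisfying dist(□(v), □(v′)) ≥ 1, then we consider every propagator corresponding to a line connecting these
vertices as an external field also. Such a possibility is assured by the following estimates ‖hG_k(Ω,B̃)h′‖_{1,α} ≤
O(1)e^{−δ₀dist(□(v),□(v′))}, (3.1)"*.  HERE: for every `0 ≤ α < 1` there are `δ₀ > 0`, `C > 0` (on `d + 1`, `L = ℓ + 1`, the window and
`α`; NOT on `B̃₀`, `κ`, the flow) such that for every scale `k ≥ 1`, window point, box `□ = Π_μ[0,M_μ)` and EVERY CONSTANT `B̃₀`,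
`(sect3ConstBox F κ B̃₀ ℓ k M a m²).Ineq31 α δ₀ C`: for unit cubes at distance `≥ 1`,
`‖1_{□(v)}G^η_k(□,B̃₀)1_{□(v′)}‖_{1,α} ≤ C·e^{−δ₀dist(□(v),□(v′))}`, the norm being the two-variable (1.32) with COVARIANT derivatives
`D^η_{B̃₀}` in both variables and the TRANSPORTS `U(B̃₀(Γ))` on both sides.  ROUTE = the print's p. 433 gauge step: the propagator
is the gauge conjugate of the zero-field one (`B3Eq26ConstBox.GfineA0_eq`), every ingredient of the norm is the zero-field one
times an orthogonal transporter (§3), so the norm is dominated by the zero-field norm (`normHGHA_le`), bounded by this seat's gen-4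
`B3Ineq31ZeroBox.ineq31_zeroBox`.  HONEST SCOPE: (i) `Ω = □` (Neumann box), `B̃₀` CONSTANT (general small `B̃` needs the p. 433
`B̃′`-expansion, not formalised), unit-cube (indicator) localizations, «similarly for the vector field propagator» not treated;
(ii) block values read as functions `ι → ι → ℝ` with the sup norm over entries (for the blocks `c·U` met here `≤ |c|`); (iii) abelian
one-parameter orthogonal structure group, box not torus; (iv) `∀ α ∃ (δ₀, C)` as in the zero-field instance (G-B3-11), sup
distances, existential constants; (v) no Literature fact minted; standard axioms. [cite: Balaban1983Higgs3, (3.1) p.432] -/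
theorem ineq31_constBox (F : OrthFlow ι) (κ : ℝ) (d ℓ : ℕ) (hℓ : 1 ≤ ℓ) (amin aplus m2plus : ℝ) (ha : 0 < amin)
    {α : ℝ} (hα0 : 0 ≤ α) (hα1 : α < 1) :
    ∃ δ₀ C : ℝ, 0 < δ₀ ∧ 0 < C ∧ ∀ (k : ℕ), 1 ≤ k → ∀ (a m2 : ℝ), amin ≤ a → a ≤ aplus → 0 ≤ m2 → m2 ≤ m2plus →
      ∀ (M : Fin (d + 1) → ℕ), (∀ i, 1 ≤ M i) → ∀ (A₀ : Fin (d + 1) → ℝ),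
        (sect3ConstBox F κ A₀ ℓ k M a m2).Ineq31 α δ₀ C := by
  obtain ⟨δ₀, C, hδ, hC, h⟩ := ineq31_zeroBox d ℓ hℓ amin aplus m2plus ha hα0 hα1
  refine ⟨δ₀, C, hδ, hC, fun k hk a m2 h1 h2 h3 h4 M hM A₀ => ?_⟩
  rw [ineq31_iff]
  intro v v' hvv
  have ha0 : 0 < a := lt_of_lt_of_le ha h1
  exact (normHGHA_le hℓ hk hM ha0 h3 α v v').trans ((B3Ineq31ZeroBox.ineq31_iff ℓ k M a m2 α δ₀ C).1
    (h k hk a m2 h1 h2 h3 h4 M hM) v v' hvv)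

/-- **witness**: (3.1) at `α = 1/2` holds with positive constants for the concrete constant-background instance of
`B3Ineq210ConstBox` (`d + 1 = 3`, `L = 2`, `k = 1`, unit box, `N = 2` rotation flow, `κ = 1`, `B̃₀ ≡ π` — link variables `U(π) = −1`,
not gauge-trivial, `B3Eq26ConstBox`/`B3Ineq210ConstBox.witness_link_ne_one`). [cite: Balaban1983Higgs3, (3.1) p.432] -/
theorem ineq31_constBox_witness :
    ∃ δ₀ C : ℝ, 0 < δ₀ ∧ 0 < C ∧
      (sect3ConstBox OrthFlow.rot 1 (fun _ : Fin (2 + 1) => Real.pi) 1 1 (fun _ => 1) 1 (1 / 2)).Ineq31 (1 / 2) δ₀ C := by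
  obtain ⟨δ₀, C, hδ, hC, h⟩ := ineq31_constBox OrthFlow.rot 1 2 1 le_rfl 1 1 1 one_pos (α := 1 / 2) (by norm_num) (by norm_num)
  exact ⟨δ₀, C, hδ, hC, h 1 le_rfl 1 (1 / 2) le_rfl le_rfl (by norm_num) (by norm_num) (fun _ => 1) (fun _ => le_rfl) _⟩

end Discharge

end

end Literature.MathematicalPhysics.QuantumFieldTheory.Balaban1983to89.B3Ineq31ConstBox
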